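import Literature.NumberTheory.LFunctions.LagariasXiPositivityEq14Proofs
import Literature.NumberTheory.LFunctions.LiCoefficientsModelSpaceRH
import Literature.NumberTheory.LFunctions.LagariasXiStructureFunctionProofs

/-!
# LagariasZeroFreeDoor — door lemmas: RH ⇐ (zero-free ∧ bounded) bookkeeping; no zero-free input proved here
(column DBR; card `zero-free-door` of rh-dbr-idea-1 g3)

LABELS.  Every theorem below is an RH-FREE implication between explicit statements about Lagarias' structure
function `E_ξ` (`lagariasE`) and its inner quotient `Θ_ξ = E♯/E` (`lagariasTheta`); the door itself
(`RH ⟺ E_ξ zero-free on ℂ₊`) is RH-EQUIVALENT and is NOT claimed; the two classical analytic inputs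
`MinModulusCircles` (Hadamard–Boutroux–Cartan minimum modulus for the order-1 entire function `E_ξ`) and
`StripMaxPrinciple` (Phragmén–Lindelöf on truncated strips) are TYPED, not proved.  Nothing here bears on the truth
of RH.  Filed by the engine seat at the director's word (rh-dbr INBOX 2026-08-26T11:44:43Z: «[rh-dbr-eng] MAY land
them as ONE Theorems module … label the module docstring «door lemmas: RH ⇐ (zero-free ∧ bounded) bookkeeping; no
zero-free input proved here»»); statements and proofs are rh-dbr-idea-1 g3's (HOME/rh-dbr-idea-1/g3-ZeroFreeDoor_probe.lean,
kernel-checked rc 0 there), copied verbatim up to docstring labels.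

* `cayleyHalfPlaneControl` — RH-FREE: `E_ξ ≠ 0` and `|Θ_ξ| < 1` on `Im z ≥ 1/2`, from the tree's `Re ξ′/ξ(s) > 0` for
  `Re s ≥ 1` (`Lagarias1999Eq14.re_logDeriv_riemannXi_pos_of_one_le_re`) via `Θ_ξ = (1 − w)/(1 + w)`, `w = ξ′/ξ(½ − iz)`;
* `riemannHypothesis_of_zeroFree_of_bounded` — RH-FREE reduction: zero-free ∧ bounded ⟹ RH (the tree's inner-function
  door `riemannHypothesis_of_isMeromorphicInnerUHP`, its inner clauses discharged);
* `zeroFreeDoor_of : MinModulusCircles → StripMaxPrinciple → ZeroFreeDoor`, `zeroFreeDoorIff_of`.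

References: J. C. Lagarias, Acta Arith. 89 (1999) (1.4); L. de Branges, *Hilbert Spaces of Entire Functions* (1968);
R. P. Boas, *Entire Functions*, Thm 3.7.1.
-/

noncomputable section

-- D-0017: `Summit.<S>.<S>.…` is the designed namespace of a single-problem summit.
set_option linter.dupNamespace false

open Complex
open Literature.NumberTheory.LFunctions Literature.Analysis.DeBrangesSpaces

namespace Summit.RiemannHypothesis.RiemannHypothesis.Theorems.LagariasZeroFreeDoor

/-! ## The two remaining inputs, typed exactly as in `g3-Sketch.lean` -/

/-- RH-FREE (L): Hadamard–Boutroux–Cartan minimum modulus for `E_ξ` (order 1 < 1+ε): circles `|z| = r_k → ∞`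
on which `|E_ξ| ≥ exp(−r^{1+ε})` (Boas, *Entire Functions*, Thm 3.7.1). -/
def MinModulusCircles : Prop :=
  ∀ ε : ℝ, 0 < ε → ∀ R : ℝ, ∃ r : ℝ, R ≤ r ∧
    ∀ z : ℂ, ‖z‖ = r → Real.exp (-(r ^ (1 + ε))) ≤ ‖lagariasE z‖

/-- RH-FREE (M): maximum modulus on the truncated strips `{0 < Im z < 1/2, |z| < r_k}` with the damping factor
`exp(−δ(e^{bz} + e^{−bz}))`, `0 < b < π`, then `k → ∞`, `δ → 0`. -/
def StripMaxPrinciple : Prop :=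
  (∀ z : ℂ, 0 < z.im → z.im < 1 / 2 → lagariasE z ≠ 0) →
    (∀ z : ℂ, z.im = 1 / 2 → ‖lagariasTheta z‖ ≤ 1) → MinModulusCircles →
      ∀ z : ℂ, 0 < z.im → z.im < 1 / 2 → ‖lagariasTheta z‖ ≤ 1

/-- RH-EQUIVALENT·DERIVED TARGET SHAPE (definition only, NOT claimed): the door's ⟸ half, `E_ξ` zero-free on `ℂ₊` ⟹ RH
(theorem candidate T of the card; its ⟹ half is the tree's `lagariasE_ne_zero_of_im_pos`). -/
def ZeroFreeDoor : Prop := (∀ z : ℂ, 0 < z.im → lagariasE z ≠ 0) → RiemannHypothesis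

/-! ## Step (1): closed half-plane `Im z ≥ 1/2` -/


/-- RH-FREE: `E_ξ ≠ 0` and `|Θ_ξ| < 1` on `Im z ≥ 1/2`. -/
theorem cayleyHalfPlaneControl (z : ℂ) (hz : 1 / 2 ≤ z.im) :
    lagariasE z ≠ 0 ∧ ‖lagariasTheta z‖ < 1 := by
  set s : ℂ := 1 / 2 - I * z with hs
  have hre : 1 ≤ s.re := by
    have : s.re = 1 / 2 + z.im := by simp [hs]
    rw [this]; linarith
  have hpos := Lagarias1999Eq14.re_logDeriv_riemannXi_pos_of_one_le_re hre
  have hxi : riemannXi s ≠ 0 := by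
    intro h0
    rw [logDeriv_apply, h0, div_zero, Complex.zero_re] at hpos
    exact lt_irrefl _ hpos
  set w : ℂ := logDeriv riemannXi s with hw
  have hderiv : deriv riemannXi s = riemannXi s * w := by
    rw [hw, logDeriv_apply, mul_div_cancel₀ _ hxi]
  have hE : lagariasE z = riemannXi s * (1 + w) := by
    rw [lagariasE_eq_lagariasXiA_add, lagariasXiA_eq, ← hs, hderiv]; ring
  have hEs : sharp lagariasE z = riemannXi s * (1 - w) := by
    rw [sharp_lagariasE, ← hs, hderiv]; ring
  have h1w : 1 + w ≠ 0 := by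
    intro h
    have := congrArg Complex.re h
    simp at this
    linarith
  refine ⟨by rw [hE]; exact mul_ne_zero hxi h1w, ?_⟩
  have hΘ : lagariasTheta z = (1 - w) / (1 + w) := by
    show sharp lagariasE z / lagariasE z = _
    rw [hEs, hE, mul_div_mul_left _ _ hxi]
  rw [hΘ, norm_div, div_lt_one (norm_pos_iff.mpr h1w)]
  have hsq : ‖1 - w‖ ^ 2 < ‖1 + w‖ ^ 2 := by
    rw [Complex.sq_norm, Complex.sq_norm, Complex.normSq_apply, Complex.normSq_apply]
    simp only [sub_re, one_re, sub_im, one_im, zero_sub, add_re, add_im, zero_add]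
    nlinarith
  exact lt_of_pow_lt_pow_left₀ 2 (norm_nonneg _) hsq

/-- Consequence used by `StripMaxPrinciple`: `|Θ_ξ| ≤ 1` on the line `Im z = 1/2`. RH-FREE. -/
theorem norm_lagariasTheta_le_one_of_im_eq_half (z : ℂ) (hz : z.im = 1 / 2) :
    ‖lagariasTheta z‖ ≤ 1 :=
  ((cayleyHalfPlaneControl z hz.symm.le).2).le


/-! ## Step (3) and the ⟹ half -/


/-- RH-FREE (bookkeeping; idea-1 g3's proof). KERNEL-CHECKED REDUCTION: zero-free + bounded ⟹ RH, by the tree's Phragmén–Lindelöf /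
max-modulus theorem `riemannHypothesis_of_isMeromorphicInnerUHP` (its «inner» clauses 3–4 are RH-free
facts about `Θ_ξ`: a.e. boundary modulus `1` by continuity at the real non-zeros of `E_ξ`, meromorphy on
`ℂ`). Hence `ZeroFreeDoor` is EXACTLY as hard as `ThetaBounded_of_zeroFree`. No sorry. -/
theorem riemannHypothesis_of_zeroFree_of_bounded
    (hzf : ∀ z : ℂ, 0 < z.im → lagariasE z ≠ 0)
    (hbdd : ∃ C : ℝ, ∀ z : ℂ, 0 < z.im → ‖lagariasTheta z‖ ≤ C) : RiemannHypothesis := by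
  have hΘ : lagariasTheta = fun z ↦ sharp lagariasE z / lagariasE z := rfl
  refine riemannHypothesis_of_isMeromorphicInnerUHP ⟨?_, hbdd, ?_,
    ⟨lagariasTheta, meromorphicOn_lagariasTheta, fun _ _ ↦ rfl⟩⟩
  · rw [hΘ]
    exact (differentiable_sharp differentiable_lagariasE).differentiableOn.div
      differentiable_lagariasE.differentiableOn fun z hz ↦ hzf z hz
  · filter_upwards [ae_lagariasE_ofReal_ne_zero] with x hx
    have hc : ContinuousAt lagariasTheta x := by
      rw [hΘ]
      exact ((differentiable_sharp differentiable_lagariasE).continuous.continuousAt).div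
        continuous_lagariasE.continuousAt hx
    have hpath : Filter.Tendsto (fun y : ℝ ↦ (x : ℂ) + I * y) (nhdsWithin 0 (Set.Ioi 0)) (nhds (x : ℂ)) := by
      have hc' : Continuous (fun y : ℝ ↦ (x : ℂ) + I * y) := by fun_prop
      have h0 := hc'.tendsto 0
      simp only [Complex.ofReal_zero, mul_zero, add_zero] at h0
      exact h0.mono_left nhdsWithin_le_nhds
    have hlim := (hc.tendsto.comp hpath).norm
    rw [norm_lagariasTheta_ofReal hx] at hlim
    exact hlim

/-! ## The skeleton: T from the two classical inputs -/

/-- RH-FREE (bookkeeping; idea-1 g3's proof). KERNEL-CHECKED COMPOSITION: `MinModulusCircles → StripMaxPrinciple → ZeroFreeDoor`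
(no zero-free input and neither classical input is proved here). -/
theorem zeroFreeDoor_of (hmin : MinModulusCircles) (hstrip : StripMaxPrinciple) : ZeroFreeDoor := by
  intro hzf
  apply riemannHypothesis_of_zeroFree_of_bounded hzf
  refine ⟨1, fun z hz ↦ ?_⟩
  rcases lt_or_ge z.im (1 / 2) with h | h
  · exact hstrip (fun z hz _ ↦ hzf z hz) (fun z hz ↦ norm_lagariasTheta_le_one_of_im_eq_half z hz) hmin z hz h
  · exact (cayleyHalfPlaneControl z h).2.le

/-- RH-FREE (bookkeeping). The door, both halves: `(MinModulusCircles ∧ StripMaxPrinciple) → (RH ↔ E_ξ zero-free on ℂ₊)`;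
the equivalence itself is RH-EQUIVALENT by construction and certifies nothing about RH. -/
theorem zeroFreeDoorIff_of (hmin : MinModulusCircles) (hstrip : StripMaxPrinciple) :
    RiemannHypothesis ↔ ∀ z : ℂ, 0 < z.im → lagariasE z ≠ 0 :=
  ⟨fun h _ hz ↦ lagariasE_ne_zero_of_im_pos h hz, zeroFreeDoor_of hmin hstrip⟩

end Summit.RiemannHypothesis.RiemannHypothesis.Theorems.LagariasZeroFreeDoor

end
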